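import Summits.QuantumFields.YangMills.Theorems.UnitScaleTiltFluctuationComparisonRegPrLiftPlaquette
import Literature.MathematicalPhysics.QuantumFieldTheory.Balaban1983to89.UnitaryModel

/-!
# Route `UnitScaleTilt` — crux K1bR-pr `FluctuationComparisonRegPr` (stmt-QuantumFields-19201), stub `stub_oneStepSmallLift`
# (W7 line), piece (L2-iii)(a), second layer: THE TWISTED COBOUNDARY TO SECOND ORDER
# (support file `--supports stmt-QuantumFields-19201`)

Cell `ym3-torus` (rung R3), seat `ym3-torus-p2` gen 8; CARD-19201-oneStepSmallLift-L1L2.md §2.  `…LiftPlaquette` gave the exact identity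
`(E·W)(∂p) = twistedCobd E W p · W(∂p)` and the crude triangle bound.  Here the CANCELLATION inside the twisted coboundary is made available:

* `norm_prod_four_sub_le` (any normed ring): `‖(1+D₁)(1+D₂)(1+D₃)(1+D₄) − 1 − (D₁+D₂+D₃+D₄)‖ ≤ 6t² + 4t³ + t⁴` for `‖D_i‖ ≤ t`;
* `norm_twistedCobd_sub_one_sub_lin_le` (`SU(N)`, `L²`-operator norm): `‖twistedCobd − 1 − linCobd‖ ≤ 6t² + 4t³ + t⁴`, where
  `linCobd = (E₁−1) + T₁(E₂−1)T₁⁻¹ + T₃(E₃⁻¹−1)T₃⁻¹ + T₄(E₄⁻¹−1)T₄⁻¹` is the LINEARISED TWISTED COBOUNDARY (for `E = exp ζ` it is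
  `ζ₁ + Ad_{T₁}ζ₂ − Ad_{T₃}ζ₃ − Ad_{T₄}ζ₄ + O(ζ²)` — the `(d_W ζ)(p)` the linear certificate controls) and `t` bounds `dist1 (E b)` on `∂p`;
* hence `dist1 ((E·W)(∂p)) ≤ ‖linCobd‖ + 6t² + 4t³ + t⁴ + dist1 (W(∂p))` (`dist1_plaqHol_mulField_le_lin`).

Elementary; nothing of Bałaban's is asserted.
-/

noncomputable section

open scoped Matrix.Norms.L2Operator

namespace Summit.QuantumFields.YangMills.Theorems.ApproxLift

open Literature.MathematicalPhysics.QuantumFieldTheory.Balaban1983to89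

/-! ## §1 Products of four near-identity elements in a normed ring -/

section Ring

variable {𝔸 : Type*} [NormedRing 𝔸]

/-- The second-order remainder of a product of four: `(1+D₁)(1+D₂)(1+D₃)(1+D₄) − 1 − ΣD_i` (explicit noncommutative polynomial). -/
theorem prod_four_expand (D₁ D₂ D₃ D₄ : 𝔸) :
    (1 + D₁) * (1 + D₂) * (1 + D₃) * (1 + D₄) - 1 - (D₁ + D₂ + D₃ + D₄) =
      (D₁ * D₂ + (D₁ + D₂ + D₁ * D₂) * D₃) + (D₁ + D₂ + D₃ + (D₁ * D₂ + (D₁ + D₂ + D₁ * D₂) * D₃)) * D₄ := by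
  noncomm_ring

/-- **SECOND-ORDER BOUND FOR A PRODUCT OF FOUR NEAR-IDENTITY ELEMENTS**: `‖Π(1+D_i) − 1 − ΣD_i‖ ≤ 6t² + 4t³ + t⁴` for `‖D_i‖ ≤ t`. -/
theorem norm_prod_four_sub_le {D₁ D₂ D₃ D₄ : 𝔸} {t : ℝ} (h₁ : ‖D₁‖ ≤ t) (h₂ : ‖D₂‖ ≤ t) (h₃ : ‖D₃‖ ≤ t) (h₄ : ‖D₄‖ ≤ t) :
    ‖(1 + D₁) * (1 + D₂) * (1 + D₃) * (1 + D₄) - 1 - (D₁ + D₂ + D₃ + D₄)‖ ≤ 6 * t ^ 2 + 4 * t ^ 3 + t ^ 4 := by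
  have ht : 0 ≤ t := (norm_nonneg _).trans h₁
  rw [prod_four_expand]
  have h12 : ‖D₁ * D₂‖ ≤ t * t := (norm_mul_le _ _).trans (mul_le_mul h₁ h₂ (norm_nonneg _) ht)
  have hS2 : ‖D₁ + D₂ + D₁ * D₂‖ ≤ t + t + t * t :=
    (norm_add_le _ _).trans (add_le_add ((norm_add_le _ _).trans (add_le_add h₁ h₂)) h12)
  have hR3 : ‖D₁ * D₂ + (D₁ + D₂ + D₁ * D₂) * D₃‖ ≤ t * t + (t + t + t * t) * t :=
    (norm_add_le _ _).trans (add_le_add h12 ((norm_mul_le _ _).trans (mul_le_mul hS2 h₃ (norm_nonneg _) (by positivity))))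
  have hS3 : ‖D₁ + D₂ + D₃ + (D₁ * D₂ + (D₁ + D₂ + D₁ * D₂) * D₃)‖ ≤ t + t + t + (t * t + (t + t + t * t) * t) :=
    (norm_add_le _ _).trans (add_le_add ((norm_add_le _ _).trans (add_le_add ((norm_add_le _ _).trans (add_le_add h₁ h₂)) h₃)) hR3)
  have hR4 : ‖(D₁ + D₂ + D₃ + (D₁ * D₂ + (D₁ + D₂ + D₁ * D₂) * D₃)) * D₄‖ ≤ (t + t + t + (t * t + (t + t + t * t) * t)) * t :=
    (norm_mul_le _ _).trans (mul_le_mul hS3 h₄ (norm_nonneg _) (by positivity))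
  calc _ ≤ ‖D₁ * D₂ + (D₁ + D₂ + D₁ * D₂) * D₃‖ + ‖(D₁ + D₂ + D₃ + (D₁ * D₂ + (D₁ + D₂ + D₁ * D₂) * D₃)) * D₄‖ := norm_add_le _ _
    _ ≤ (t * t + (t + t + t * t) * t) + (t + t + t + (t * t + (t + t + t * t) * t)) * t := add_le_add hR3 hR4
    _ = 6 * t ^ 2 + 4 * t ^ 3 + t ^ 4 := by ring

end Ring

/-! ## §2 The twisted coboundary in the matrix model `SU(N)` -/

section SUN

variable {P : Params} {j : ℕ} {N : Type*} [Fintype N] [DecidableEq N] [Nonempty N]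

omit [Nonempty N] in
/-- Coercion of a conjugate: `↑(T g T⁻¹) = ↑T ↑g (↑T)⁻¹`-free form `↑T * ↑g * ↑T⁻¹`. -/
private theorem coe_conj (T g : Matrix.specialUnitaryGroup N ℂ) :
    ((T * g * T⁻¹ : Matrix.specialUnitaryGroup N ℂ) : Matrix N N ℂ) = (T : Matrix N N ℂ) * (g : Matrix N N ℂ) * ((T⁻¹ : Matrix.specialUnitaryGroup N ℂ) : Matrix N N ℂ) := by
  simp only [Submonoid.coe_mul]

omit [Nonempty N] in
/-- `↑T * ↑T⁻¹ = 1` in the matrix model. -/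
private theorem coe_mul_coe_inv (T : Matrix.specialUnitaryGroup N ℂ) :
    (T : Matrix N N ℂ) * ((T⁻¹ : Matrix.specialUnitaryGroup N ℂ) : Matrix N N ℂ) = 1 := by
  rw [← Submonoid.coe_mul, mul_inv_cancel]; rfl

omit [Nonempty N] in
/-- A conjugate minus one is the conjugate of (the element minus one): `↑T ↑g ↑T⁻¹ − 1 = ↑T (↑g − 1) ↑T⁻¹`. -/
private theorem conj_sub_one (T g : Matrix.specialUnitaryGroup N ℂ) :
    (T : Matrix N N ℂ) * (g : Matrix N N ℂ) * ((T⁻¹ : Matrix.specialUnitaryGroup N ℂ) : Matrix N N ℂ) - 1 =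
      (T : Matrix N N ℂ) * ((g : Matrix N N ℂ) - 1) * ((T⁻¹ : Matrix.specialUnitaryGroup N ℂ) : Matrix N N ℂ) := by
  rw [mul_sub, sub_mul, mul_one, coe_mul_coe_inv]

/-- `dist1` of a conjugate element bounds the norm of the conjugated difference: `‖↑T (↑g − 1) ↑T⁻¹‖ = dist1 g`. -/
private theorem norm_conj_sub_one (T g : Matrix.specialUnitaryGroup N ℂ) :
    ‖(T : Matrix N N ℂ) * ((g : Matrix N N ℂ) - 1) * ((T⁻¹ : Matrix.specialUnitaryGroup N ℂ) : Matrix N N ℂ)‖ = dist1 g := by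
  rw [← conj_sub_one, ← coe_conj]
  exact GaugeGroup.dist1_conj g T

/-- THE LINEARISED TWISTED COBOUNDARY (matrix): `(E₁−1) + T₁(E₂−1)T₁⁻¹ + T₃(E₃⁻¹−1)T₃⁻¹ + T₄(E₄⁻¹−1)T₄⁻¹` with the transports of
`twistedCobd`. -/
def linCobd (E W : GaugeField P j (Matrix.specialUnitaryGroup N ℂ)) (p : Plaq P j) : Matrix N N ℂ :=
  (((E ⟨p.src, p.μ⟩ : Matrix.specialUnitaryGroup N ℂ) : Matrix N N ℂ) - 1) +
  (((W ⟨p.src, p.μ⟩ : Matrix.specialUnitaryGroup N ℂ) : Matrix N N ℂ) * (((E ⟨p.src.shift p.μ, p.ν⟩ : Matrix.specialUnitaryGroup N ℂ) : Matrix N N ℂ) - 1) *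
      (((W ⟨p.src, p.μ⟩)⁻¹ : Matrix.specialUnitaryGroup N ℂ) : Matrix N N ℂ)) +
  (((W ⟨p.src, p.μ⟩ * W ⟨p.src.shift p.μ, p.ν⟩ * (W ⟨p.src.shift p.ν, p.μ⟩)⁻¹ : Matrix.specialUnitaryGroup N ℂ) : Matrix N N ℂ) *
      ((((E ⟨p.src.shift p.ν, p.μ⟩)⁻¹ : Matrix.specialUnitaryGroup N ℂ) : Matrix N N ℂ) - 1) *
      (((W ⟨p.src, p.μ⟩ * W ⟨p.src.shift p.μ, p.ν⟩ * (W ⟨p.src.shift p.ν, p.μ⟩)⁻¹)⁻¹ : Matrix.specialUnitaryGroup N ℂ) : Matrix N N ℂ)) +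
  (((GaugeField.plaqHol W p : Matrix.specialUnitaryGroup N ℂ) : Matrix N N ℂ) *
      ((((E ⟨p.src, p.ν⟩)⁻¹ : Matrix.specialUnitaryGroup N ℂ) : Matrix N N ℂ) - 1) *
      (((GaugeField.plaqHol W p)⁻¹ : Matrix.specialUnitaryGroup N ℂ) : Matrix N N ℂ))

/-- **THE TWISTED COBOUNDARY TO SECOND ORDER** in `SU(N)`: if the four bond variables of `E` on `∂p` are within `t` of `1`, then
`‖↑(twistedCobd E W p) − 1 − linCobd E W p‖ ≤ 6t² + 4t³ + t⁴`. -/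
theorem norm_twistedCobd_sub_one_sub_lin_le (E W : GaugeField P j (Matrix.specialUnitaryGroup N ℂ)) (p : Plaq P j) {t : ℝ}
    (h₁ : dist1 (E ⟨p.src, p.μ⟩) ≤ t) (h₂ : dist1 (E ⟨p.src.shift p.μ, p.ν⟩) ≤ t) (h₃ : dist1 (E ⟨p.src.shift p.ν, p.μ⟩) ≤ t)
    (h₄ : dist1 (E ⟨p.src, p.ν⟩) ≤ t) :
    ‖((twistedCobd E W p : Matrix.specialUnitaryGroup N ℂ) : Matrix N N ℂ) - 1 - linCobd E W p‖ ≤ 6 * t ^ 2 + 4 * t ^ 3 + t ^ 4 := by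
  -- the four near-identity factors `1 + D_i`
  set T₁ : Matrix.specialUnitaryGroup N ℂ := W ⟨p.src, p.μ⟩ with hT₁
  set T₃ : Matrix.specialUnitaryGroup N ℂ := W ⟨p.src, p.μ⟩ * W ⟨p.src.shift p.μ, p.ν⟩ * (W ⟨p.src.shift p.ν, p.μ⟩)⁻¹ with hT₃
  set T₄ : Matrix.specialUnitaryGroup N ℂ := GaugeField.plaqHol W p with hT₄
  set D₁ : Matrix N N ℂ := ((E ⟨p.src, p.μ⟩ : Matrix.specialUnitaryGroup N ℂ) : Matrix N N ℂ) - 1 with hD₁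
  set D₂ : Matrix N N ℂ := (T₁ : Matrix N N ℂ) * (((E ⟨p.src.shift p.μ, p.ν⟩ : Matrix.specialUnitaryGroup N ℂ) : Matrix N N ℂ) - 1) * ((T₁⁻¹ : Matrix.specialUnitaryGroup N ℂ) : Matrix N N ℂ) with hD₂
  set D₃ : Matrix N N ℂ := (T₃ : Matrix N N ℂ) * ((((E ⟨p.src.shift p.ν, p.μ⟩)⁻¹ : Matrix.specialUnitaryGroup N ℂ) : Matrix N N ℂ) - 1) * ((T₃⁻¹ : Matrix.specialUnitaryGroup N ℂ) : Matrix N N ℂ) with hD₃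
  set D₄ : Matrix N N ℂ := (T₄ : Matrix N N ℂ) * ((((E ⟨p.src, p.ν⟩)⁻¹ : Matrix.specialUnitaryGroup N ℂ) : Matrix N N ℂ) - 1) * ((T₄⁻¹ : Matrix.specialUnitaryGroup N ℂ) : Matrix N N ℂ) with hD₄
  have hlin : linCobd E W p = D₁ + D₂ + D₃ + D₄ := rfl
  have e1 : (1 : Matrix N N ℂ) + D₁ = ((E ⟨p.src, p.μ⟩ : Matrix.specialUnitaryGroup N ℂ) : Matrix N N ℂ) := by rw [hD₁]; abel
  have e2 : (1 : Matrix N N ℂ) + D₂ = (T₁ : Matrix N N ℂ) * ((E ⟨p.src.shift p.μ, p.ν⟩ : Matrix.specialUnitaryGroup N ℂ) : Matrix N N ℂ) * ((T₁⁻¹ : Matrix.specialUnitaryGroup N ℂ) : Matrix N N ℂ) := by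
    rw [hD₂, ← conj_sub_one]; abel
  have e3 : (1 : Matrix N N ℂ) + D₃ = (T₃ : Matrix N N ℂ) * (((E ⟨p.src.shift p.ν, p.μ⟩)⁻¹ : Matrix.specialUnitaryGroup N ℂ) : Matrix N N ℂ) * ((T₃⁻¹ : Matrix.specialUnitaryGroup N ℂ) : Matrix N N ℂ) := by
    rw [hD₃, ← conj_sub_one]; abel
  have e4 : (1 : Matrix N N ℂ) + D₄ = (T₄ : Matrix N N ℂ) * (((E ⟨p.src, p.ν⟩)⁻¹ : Matrix.specialUnitaryGroup N ℂ) : Matrix N N ℂ) * ((T₄⁻¹ : Matrix.specialUnitaryGroup N ℂ) : Matrix N N ℂ) := by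
    rw [hD₄, ← conj_sub_one]; abel
  have hprod : ((twistedCobd E W p : Matrix.specialUnitaryGroup N ℂ) : Matrix N N ℂ) = (1 + D₁) * (1 + D₂) * (1 + D₃) * (1 + D₄) := by
    rw [e1, e2, e3, e4, hT₁, hT₃, hT₄]
    simp only [twistedCobd, Submonoid.coe_mul]
  rw [hlin, hprod]
  have hn₁ : ‖D₁‖ ≤ t := h₁
  have hn₂ : ‖D₂‖ ≤ t := by rw [hD₂, norm_conj_sub_one]; exact h₂
  have hn₃ : ‖D₃‖ ≤ t := by rw [hD₃, norm_conj_sub_one, GaugeGroup.dist1_inv]; exact h₃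
  have hn₄ : ‖D₄‖ ≤ t := by rw [hD₄, norm_conj_sub_one, GaugeGroup.dist1_inv]; exact h₄
  exact norm_prod_four_sub_le hn₁ hn₂ hn₃ hn₄

/-- **PLAQUETTES OF `E·W` TO SECOND ORDER**: `dist1 ((E·W)(∂p)) ≤ ‖linCobd E W p‖ + (6t² + 4t³ + t⁴) + dist1 (W(∂p))`. -/
theorem dist1_plaqHol_mulField_le_lin (E W : GaugeField P j (Matrix.specialUnitaryGroup N ℂ)) (p : Plaq P j) {t : ℝ}
    (h₁ : dist1 (E ⟨p.src, p.μ⟩) ≤ t) (h₂ : dist1 (E ⟨p.src.shift p.μ, p.ν⟩) ≤ t) (h₃ : dist1 (E ⟨p.src.shift p.ν, p.μ⟩) ≤ t)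
    (h₄ : dist1 (E ⟨p.src, p.ν⟩) ≤ t) :
    dist1 (GaugeField.plaqHol (mulField E W) p) ≤ ‖linCobd E W p‖ + (6 * t ^ 2 + 4 * t ^ 3 + t ^ 4) + dist1 (GaugeField.plaqHol W p) := by
  rw [plaqHol_mul_left]
  refine (GaugeGroup.dist1_mul_le _ _).trans (add_le_add ?_ le_rfl)
  have h := norm_twistedCobd_sub_one_sub_lin_le E W p h₁ h₂ h₃ h₄
  set X : Matrix N N ℂ := ((twistedCobd E W p : Matrix.specialUnitaryGroup N ℂ) : Matrix N N ℂ) with hX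
  change ‖X - 1‖ ≤ _
  have hsplit : X - 1 = linCobd E W p + (X - 1 - linCobd E W p) := by abel
  calc ‖X - 1‖ = ‖linCobd E W p + (X - 1 - linCobd E W p)‖ := by rw [← hsplit]
    _ ≤ ‖linCobd E W p‖ + ‖X - 1 - linCobd E W p‖ := norm_add_le _ _
    _ ≤ ‖linCobd E W p‖ + (6 * t ^ 2 + 4 * t ^ 3 + t ^ 4) := add_le_add le_rfl h

end SUN

end Summit.QuantumFields.YangMills.Theorems.ApproxLift

end
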